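import Summits.Ventures.PackingBounds.ThreePointCert.CheckFastF

/-!
# Trie-free check of the three-point part (sorted-merge zero test)

Framing: lottery ticket; floor = certified bounds/negative ranges. Venture `PackingBounds`
(cell `pub-packcert`), three-point SDP family.

`ThreePointCert.CheckFastF.FchunkOKK` validates `Dprev + FPolyK bs - Dnext ≡ 0` with the trie-based
`residualBound`; at n = 7, d = 12 the kernel exceeds its memory bound when the terms produced by
`FPolyK` (deep unevaluated monomial expressions from the `QI`/`symTabG` tables) are pushed through
the trie (blocks k ≥ 6), although the polynomial itself evaluates in under a minute. `FchunkOKZ`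
instead merges the three sorted term lists with `mergeAll` and checks that every coefficient of the
result is zero — no trie. Soundness is immediate: a term list with all coefficients zero evaluates
to `0` (`eval_eq_zero_of_all_zero`), `mergeAll` evaluates to the sum, and `FPolyK` has the value of
`FPolyG` (`eval_FPolyK`), so `fchunkVal_of_okFZ` yields the chunk validity `FChunkVal` of
`ThreePointCert.Soundness` unchanged. A `false` result (e.g. if the inputs were not consistently
sorted) is a failed check, never an unsound one.
-/

noncomputable section

namespace Summit.Ventures.PackingBounds.ThreePointCert

open Literature.Geometry.DiscreteGeometry Literature.Geometry.DiscreteGeometry.PolyCert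
open Literature.Geometry.DiscreteGeometry.PolyCert.SPoly

/-- Trie-free block-chunk check of the three-point part: merge `Dprev`, `FPolyK bs`, `-Dnext`
(sorted term lists) and test that every coefficient cancels. -/
def FchunkOKZ (n d : ℕ) (bs : List FBlk) (Dprev Dnext : SPoly) : Bool :=
  (mergeAll [Dprev, FPolyK n d bs, neg Dnext]).all fun mc => mc.2 == 0

/-- A term list whose coefficients are all zero evaluates to zero. -/
theorem eval_eq_zero_of_all_zero (p : SPoly) (h : (p.all fun mc => mc.2 == 0) = true) (u v t : ℝ) :
    eval p u v t = 0 := by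
  induction p with
  | nil => simp [eval]
  | cons mc rest ih =>
    simp only [List.all_cons, Bool.and_eq_true, beq_iff_eq] at h
    rw [SPoly.eval_cons, ih h.2, h.1]
    simp

/-- Chunk validity (`ThreePointCert.Soundness.FChunkVal`) from the trie-free check. -/
theorem fchunkVal_of_okFZ (c : Cert3) (bs : List FBlk) (Dprev Dnext : SPoly)
    (h : FchunkOKZ c.n c.d bs Dprev Dnext = true) : FChunkVal c bs Dprev Dnext := by
  intro u v t _ _ _
  have h0 := eval_eq_zero_of_all_zero _ h u v t
  rw [eval_mergeAll] at h0
  simp only [List.map_cons, List.map_nil, List.sum_cons, List.sum_nil, add_zero, eval_neg,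
    eval_FPolyK] at h0
  linarith

end Summit.Ventures.PackingBounds.ThreePointCert

end
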